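import Literature.ModelTheory.ExponentialFields.ETermReduction
import HarnessLib

/-!
# Existential formulas of exp-term definable expansions reduce to exponential term equations

Topic `Literature/ModelTheory/ExponentialFields`.  `ETermReduction.lean` proves, for the
language `L_e = {+, ·, -, 0, 1, ≤} ∪ {e}`, that uniformly in the models `K` of `T_exp` every
existential `L_e`-formula is the projection of ONE exponential term equation
(`RealExpModel.IsExpTermDefinable`).  The argument used nothing about `e` except that its graph
`y = e(x)` is itself such a projection.  This file records the **general form** (den Besten 2016,
Lemma 2.1.5, for an arbitrary expansion `L' ⊇ L` of the language of ordered rings by function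
symbols; Wilkie 1999, p. 414): let `L'` be any language interpreted on every model `K` of `T_exp`
in such a way that

* (`hfun`) the graph `y = g(x̄)` of every function symbol `g` of `L'`, and
* (`hrel`) every relation symbol `R(x̄)` of `L'` and its negation

are exp-term definable uniformly in `K`.  Then uniformly in `K` every existential `L'`-formula is
exp-term definable (`RealExpModel.IsExpTermDefinable.of_isExistential_of_graphs`), through
unnesting of terms (`termGraph_of_graphs`).  The hypotheses hold for the ordered-ring symbols
(`funGraph_orderedRing`, `relDef_orderedRing`), are inherited by sums of languages
(`funGraph_sum`, `relDef_sum`), and hold for `e` (`funGraph_eUnary`, from `eGraph`); the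
restricted exponential `exp↾[0,1]` is treated the same way in `RestrictedExp*.lean`.

Nothing here is a named fact; all hypotheses are explicit arguments.

## References

* M. den Besten, *Wilkie's Theorem and the Uniform Real Schanuel Conjecture*, MSc thesis,
  Utrecht 2016, Lemma 2.1.5 (and its Claim). [DenBesten2016]
* A. J. Wilkie, *Model theory of analytic and smooth functions*, LMS Lecture Note Ser. 259
  (1999), p. 414. [Wilkie1999Survey]
-/

noncomputable section

open FirstOrder FirstOrder.Language FirstOrder.Language.Structure
open scoped FirstOrder

namespace Literature.ModelTheory.ExponentialFields

namespace RealExpModel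

namespace IsExpTermDefinable

universe u' v' w

variable {L' : FirstOrder.Language.{u', v'}}
  [∀ K : Language.Theory.ModelType.{0, 0, w} realExpTheory, L'.Structure K]

/-! ### Unnesting terms of an exp-term definable expansion -/

/-- **Graphs of `L'`-terms are exp-term definable** when the graphs of the function symbols of
`L'` are (unnesting: den Besten 2016, Lemma 2.1.5, Claim). [cite: DenBesten2016, Lemma 2.1.5] -/
theorem termGraph_of_graphs
    (hfun : ∀ {l : ℕ} (g : L'.Functions l),
      IsExpTermDefinable (fun (K : Language.Theory.ModelType.{0, 0, w} realExpTheory)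
        (u : Fin l ⊕ Unit → K) => u (Sum.inr ()) = funMap g (u ∘ Sum.inl)))
    {δ : Type} (s : L'.Term δ) :
    IsExpTermDefinable (fun (K : Language.Theory.ModelType.{0, 0, w} realExpTheory)
      (u : δ ⊕ Unit → K) => u (Sum.inr ()) = s.realize (u ∘ Sum.inl)) := by
  induction s with
  | var x =>
    exact (eq (var (Sum.inr ())) (var (Sum.inl x))).congr fun K u => by simp
  | func g ts ih =>
    rename_i l
    -- `∃ w̄, ⋀ᵢ wᵢ = tsᵢ ∧ y = g(w̄)`
    have hargs : IsExpTermDefinable (fun (K : Language.Theory.ModelType.{0, 0, w} realExpTheory)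
        (u : (δ ⊕ Unit) ⊕ Fin l → K) =>
          ∀ i, u (Sum.inr i) = (ts i).realize (u ∘ Sum.inl ∘ Sum.inl)) :=
      forall_fin fun i => ((ih i).comp (Definitions.argIdx δ l i)).congr fun K u => Iff.rfl
    have hval : IsExpTermDefinable (fun (K : Language.Theory.ModelType.{0, 0, w} realExpTheory)
        (u : (δ ⊕ Unit) ⊕ Fin l → K) =>
          u (Sum.inl (Sum.inr ())) = funMap g (u ∘ Sum.inr)) :=
      ((hfun g).comp (Sum.elim (fun i => Sum.inr i) fun _ => Sum.inl (Sum.inr ()) :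
          Fin l ⊕ Unit → (δ ⊕ Unit) ⊕ Fin l)).congr fun K u => Iff.rfl
    refine (exists_fin (hargs.and hval)).congr fun K u => ?_
    simp only [Sum.elim_inr, Sum.elim_inl, Term.realize_func]
    constructor
    · rintro ⟨w', hw', h⟩
      have : w' = fun i => (ts i).realize (u ∘ Sum.inl) := funext fun i => by
        rw [hw' i]; rfl
      rw [h, this]
      rfl
    · intro h
      refine ⟨fun i => (ts i).realize (u ∘ Sum.inl), fun i => rfl, ?_⟩
      rw [h]
      rfl

section Atomic

variable (hfun : ∀ {l : ℕ} (g : L'.Functions l),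
    IsExpTermDefinable (fun (K : Language.Theory.ModelType.{0, 0, w} realExpTheory)
      (u : Fin l ⊕ Unit → K) => u (Sum.inr ()) = funMap g (u ∘ Sum.inl)))
include hfun

/-- Equations between `L'`-terms are exp-term definable. [cite: DenBesten2016, Lemma 2.1.5] -/
theorem eq_of_graphs {δ : Type} (s₁ s₂ : L'.Term δ) :
    IsExpTermDefinable (fun (K : Language.Theory.ModelType.{0, 0, w} realExpTheory) (u : δ → K) =>
      s₁.realize u = s₂.realize u) := by
  refine (exists_unit ((termGraph_of_graphs hfun s₁).and (termGraph_of_graphs hfun s₂))).congr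
    fun K u => ?_
  simp only [Sum.elim_inr, Sum.elim_comp_inl]
  exact ⟨fun ⟨y, h₁, h₂⟩ => h₁.symm.trans h₂, fun h => ⟨_, rfl, h⟩⟩

/-- Inequations between `L'`-terms are exp-term definable. [cite: DenBesten2016, Lemma 2.1.5] -/
theorem ne_of_graphs {δ : Type} (s₁ s₂ : L'.Term δ) :
    IsExpTermDefinable (fun (K : Language.Theory.ModelType.{0, 0, w} realExpTheory) (u : δ → K) =>
      s₁.realize u ≠ s₂.realize u) := by
  have h : IsExpTermDefinable (fun (K : Language.Theory.ModelType.{0, 0, w} realExpTheory)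
      (u : (δ ⊕ Unit) ⊕ Unit → K) =>
        (u (Sum.inl (Sum.inr ())) = s₁.realize (u ∘ Sum.inl ∘ Sum.inl) ∧
          u (Sum.inr ()) = s₂.realize (u ∘ Sum.inl ∘ Sum.inl)) ∧
        u (Sum.inl (Sum.inr ())) ≠ u (Sum.inr ())) :=
    ((((termGraph_of_graphs hfun s₁).comp (Sum.inl : δ ⊕ Unit → (δ ⊕ Unit) ⊕ Unit)).congr
        fun K u => Iff.rfl).and
      (((termGraph_of_graphs hfun s₂).comp
          (Sum.map Sum.inl _root_.id : δ ⊕ Unit → (δ ⊕ Unit) ⊕ Unit)).congr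
        fun K u => Iff.rfl)).and
      ((ne (var (Sum.inl (Sum.inr ()))) (var (Sum.inr ()))).congr fun K u => by simp)
  refine (exists_unit (exists_unit h)).congr fun K u => ?_
  simp only [Sum.elim_inl, Sum.elim_inr]
  constructor
  · rintro ⟨y₁, y₂, ⟨h₁, h₂⟩, hne⟩
    rw [h₁, h₂] at hne
    exact hne
  · intro hne
    exact ⟨_, _, ⟨rfl, rfl⟩, hne⟩

/-- A condition on the values of `L'`-terms that is exp-term definable as a condition on
variables is exp-term definable (plug the values in through the graphs). [cite: DenBesten2016, Lemma 2.1.5] -/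
theorem rel_of_graphs {δ : Type} {l : ℕ}
    {P : ∀ K : Language.Theory.ModelType.{0, 0, w} realExpTheory, (Fin l → K) → Prop}
    (hP : IsExpTermDefinable P) (ts : Fin l → L'.Term δ) :
    IsExpTermDefinable (fun (K : Language.Theory.ModelType.{0, 0, w} realExpTheory) (u : δ → K) =>
      P K fun i => (ts i).realize u) := by
  have hargs : IsExpTermDefinable (fun (K : Language.Theory.ModelType.{0, 0, w} realExpTheory)
      (u : δ ⊕ Fin l → K) => ∀ i, u (Sum.inr i) = (ts i).realize (u ∘ Sum.inl)) :=
    forall_fin fun i =>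
      ((termGraph_of_graphs hfun (ts i)).comp (Definitions.argIdx' δ l i)).congr
        fun K u => Iff.rfl
  have hval : IsExpTermDefinable (fun (K : Language.Theory.ModelType.{0, 0, w} realExpTheory)
      (u : δ ⊕ Fin l → K) => P K (u ∘ Sum.inr)) :=
    hP.comp Sum.inr
  refine (exists_fin (hargs.and hval)).congr fun K u => ?_
  simp only [Sum.elim_inr, Sum.elim_comp_inl, Sum.elim_comp_inr]
  constructor
  · rintro ⟨w', hw', h⟩
    have : w' = fun i => (ts i).realize u := funext fun i => hw' i
    rw [this] at h
    exact h
  · intro h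
    exact ⟨fun i => (ts i).realize u, fun i => rfl, h⟩

variable (hrel : ∀ {l : ℕ} (R : L'.Relations l),
    IsExpTermDefinable (fun (K : Language.Theory.ModelType.{0, 0, w} realExpTheory)
        (u : Fin l → K) => RelMap R u) ∧
      IsExpTermDefinable (fun (K : Language.Theory.ModelType.{0, 0, w} realExpTheory)
        (u : Fin l → K) => ¬ RelMap R u))
include hrel

/-- **Normal form of quantifier-free `L'`-conditions**: uniformly in the models of `T_exp`, every
quantifier-free `L'`-formula and its negation are projections of exponential term equations
(den Besten 2016, Lemma 2.1.5). [cite: DenBesten2016, Lemma 2.1.5] -/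
theorem of_isQF_of_graphs {γ : Type} {n : ℕ} {χ : L'.BoundedFormula γ n} (hχ : χ.IsQF) :
    IsExpTermDefinable (fun (K : Language.Theory.ModelType.{0, 0, w} realExpTheory)
        (u : γ ⊕ Fin n → K) => χ.Realize (u ∘ Sum.inl) (u ∘ Sum.inr)) ∧
      IsExpTermDefinable (fun (K : Language.Theory.ModelType.{0, 0, w} realExpTheory)
        (u : γ ⊕ Fin n → K) => ¬ χ.Realize (u ∘ Sum.inl) (u ∘ Sum.inr)) := by
  induction hχ with
  | falsum =>
    exact ⟨of_false.congr fun K u => by simp [BoundedFormula.Realize],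
      of_true.congr fun K u => by simp [BoundedFormula.Realize]⟩
  | of_isAtomic h =>
    cases h with
    | equal t₁ t₂ =>
      exact ⟨(eq_of_graphs hfun t₁ t₂).congr fun K u => by simp,
        (ne_of_graphs hfun t₁ t₂).congr fun K u => by simp⟩
    | rel R ts =>
      refine ⟨(rel_of_graphs hfun (hrel R).1 ts).congr fun K u => ?_,
        (rel_of_graphs hfun (hrel R).2 ts).congr fun K u => ?_⟩
      · simp only [BoundedFormula.realize_rel, Sum.elim_comp_inl_inr]
      · simp only [BoundedFormula.realize_rel, Sum.elim_comp_inl_inr]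
  | imp _ _ ih₁ ih₂ =>
    obtain ⟨p₁, n₁⟩ := ih₁
    obtain ⟨p₂, n₂⟩ := ih₂
    refine ⟨(n₁.or p₂).congr fun K u => ?_, (p₁.and n₂).congr fun K u => ?_⟩
    · simp only [BoundedFormula.realize_imp]; tauto
    · simp only [BoundedFormula.realize_imp]; tauto

/-- **Normal form of existential `L'`-conditions** for an exp-term definable expansion `L'`:
uniformly in the models `K` of `T_exp`, every existential `L'`-formula `φ` is a projection of an
exponential term equation, `K ⊨ φ(ū) ↔ ∃ w̄, t(ū, w̄) = 0` (den Besten 2016, Lemma 2.1.5;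
Wilkie 1999, p. 414). [cite: DenBesten2016, Lemma 2.1.5] -/
theorem of_isExistential_of_graphs {γ : Type} {n : ℕ} {φ : L'.BoundedFormula γ n}
    (hφ : φ.IsExistential) :
    IsExpTermDefinable (fun (K : Language.Theory.ModelType.{0, 0, w} realExpTheory)
        (u : γ ⊕ Fin n → K) => φ.Realize (u ∘ Sum.inl) (u ∘ Sum.inr)) := by
  induction hφ with
  | of_isQF h => exact (of_isQF_of_graphs hfun hrel h).1
  | @ex n θ _ ih =>
    have h' : IsExpTermDefinable (fun (K : Language.Theory.ModelType.{0, 0, w} realExpTheory)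
        (u : (γ ⊕ Fin n) ⊕ Unit → K) =>
          θ.Realize (u ∘ Sum.inl ∘ Sum.inl) (Fin.snoc (u ∘ Sum.inl ∘ Sum.inr) (u (Sum.inr ())))) := by
      refine (ih.comp (Definitions.snocIdx γ n)).congr fun K u => ?_
      have e₁ : (u ∘ Definitions.snocIdx γ n) ∘ Sum.inl = u ∘ Sum.inl ∘ Sum.inl := by
        funext x; rfl
      have e₂ : (u ∘ Definitions.snocIdx γ n) ∘ Sum.inr =
          Fin.snoc (u ∘ Sum.inl ∘ Sum.inr) (u (Sum.inr ())) := by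
        funext j
        simp only [Function.comp_apply, Definitions.snocIdx, Sum.elim_inr]
        refine Fin.lastCases ?_ (fun i => ?_) j
        · simp
        · simp
      rw [e₁, e₂]
    refine (exists_unit h').congr fun K u => ?_
    simp only [Sum.elim_inr, BoundedFormula.realize_ex]
    rfl

end Atomic

/-! ### Verifying the hypotheses: ordered rings, sums of languages, `e` -/

/-- The graphs of the ordered-ring symbols `+, ·, -, 0, 1` (interpreted on a model of `T_exp`
through its operations) are exp-term definable. [folklore] -/
theorem funGraph_orderedRing {l : ℕ} (f : Language.orderedRing.Functions l) :
    IsExpTermDefinable (fun (K : Language.Theory.ModelType.{0, 0, w} realExpTheory)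
      (u : Fin l ⊕ Unit → K) =>
        u (Sum.inr ()) = funMap (L := Language.orderedRing) f (u ∘ Sum.inl)) := by
  refine (eq (var (Sum.inr ()))
    (func (orderedRingHomOrderedExpRing.onFunction f) fun i => var (Sum.inl i))).congr
    fun K u => ?_
  simp only [Term.realize_var, Term.realize_func]
  rw [LHom.IsExpansionOn.map_onFunction]
  rfl

/-- The relation symbol `≤` of the language of ordered rings and its negation are exp-term
definable. [folklore] -/
theorem relDef_orderedRing {l : ℕ} (R : Language.orderedRing.Relations l) :
    IsExpTermDefinable (fun (K : Language.Theory.ModelType.{0, 0, w} realExpTheory)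
        (u : Fin l → K) => RelMap (L := Language.orderedRing) R u) ∧
      IsExpTermDefinable (fun (K : Language.Theory.ModelType.{0, 0, w} realExpTheory)
        (u : Fin l → K) => ¬ RelMap (L := Language.orderedRing) R u) := by
  cases R
  exact ⟨(le (var 0) (var 1)).congr fun K u => by simp,
    (not_le (var 0) (var 1)).congr fun K u => by simp⟩

section Sum

variable {L₁ : FirstOrder.Language.{u', v'}} {L₂ : FirstOrder.Language.{u', v'}}
  [∀ K : Language.Theory.ModelType.{0, 0, w} realExpTheory, L₁.Structure K]
  [∀ K : Language.Theory.ModelType.{0, 0, w} realExpTheory, L₂.Structure K]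

/-- Exp-term definability of graphs is inherited by the sum of two languages (each model of
`T_exp` carrying the sum structure). [folklore] -/
theorem funGraph_sum
    (h₁ : ∀ {l : ℕ} (g : L₁.Functions l),
      IsExpTermDefinable (fun (K : Language.Theory.ModelType.{0, 0, w} realExpTheory)
        (u : Fin l ⊕ Unit → K) => u (Sum.inr ()) = funMap g (u ∘ Sum.inl)))
    (h₂ : ∀ {l : ℕ} (g : L₂.Functions l),
      IsExpTermDefinable (fun (K : Language.Theory.ModelType.{0, 0, w} realExpTheory)
        (u : Fin l ⊕ Unit → K) => u (Sum.inr ()) = funMap g (u ∘ Sum.inl)))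
    {l : ℕ} (g : (L₁.sum L₂).Functions l) :
    IsExpTermDefinable (fun (K : Language.Theory.ModelType.{0, 0, w} realExpTheory)
      (u : Fin l ⊕ Unit → K) => u (Sum.inr ()) = funMap g (u ∘ Sum.inl)) := by
  rcases g with g | g
  · exact (h₁ g).congr fun K u => by rw [funMap_sumInl]
  · exact (h₂ g).congr fun K u => by rw [funMap_sumInr]

/-- Exp-term definability of relations is inherited by the sum of two languages. [folklore] -/
theorem relDef_sum
    (h₁ : ∀ {l : ℕ} (R : L₁.Relations l),
      IsExpTermDefinable (fun (K : Language.Theory.ModelType.{0, 0, w} realExpTheory)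
          (u : Fin l → K) => RelMap R u) ∧
        IsExpTermDefinable (fun (K : Language.Theory.ModelType.{0, 0, w} realExpTheory)
          (u : Fin l → K) => ¬ RelMap R u))
    (h₂ : ∀ {l : ℕ} (R : L₂.Relations l),
      IsExpTermDefinable (fun (K : Language.Theory.ModelType.{0, 0, w} realExpTheory)
          (u : Fin l → K) => RelMap R u) ∧
        IsExpTermDefinable (fun (K : Language.Theory.ModelType.{0, 0, w} realExpTheory)
          (u : Fin l → K) => ¬ RelMap R u))
    {l : ℕ} (R : (L₁.sum L₂).Relations l) :
    IsExpTermDefinable (fun (K : Language.Theory.ModelType.{0, 0, w} realExpTheory)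
        (u : Fin l → K) => RelMap R u) ∧
      IsExpTermDefinable (fun (K : Language.Theory.ModelType.{0, 0, w} realExpTheory)
        (u : Fin l → K) => ¬ RelMap R u) := by
  rcases R with R | R
  · exact ⟨(h₁ R).1.congr fun K u => by rw [relMap_sumInl],
      (h₁ R).2.congr fun K u => by rw [relMap_sumInl]⟩
  · exact ⟨(h₂ R).1.congr fun K u => by rw [relMap_sumInr],
      (h₂ R).2.congr fun K u => by rw [relMap_sumInr]⟩

end Sum

/-- The graph of the symbol `e` is exp-term definable (`eGraph`). [cite: DenBesten2016, Lemma 6.2.3] -/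
theorem funGraph_eUnary {l : ℕ} (g : Language.eUnary.Functions l) :
    IsExpTermDefinable (fun (K : Language.Theory.ModelType.{0, 0, w} realExpTheory)
      (u : Fin l ⊕ Unit → K) => u (Sum.inr ()) = funMap g (u ∘ Sum.inl)) := by
  cases g
  exact (eGraph.comp (![Sum.inr (), Sum.inl 0] : Fin 2 → Fin 1 ⊕ Unit)).congr
    fun K u => Iff.rfl

/-- The language `{e}` has no relation symbols, so the relation hypothesis is vacuous. [folklore] -/
theorem relDef_eUnary {l : ℕ} (R : Language.eUnary.Relations l) :
    IsExpTermDefinable (fun (K : Language.Theory.ModelType.{0, 0, w} realExpTheory)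
        (u : Fin l → K) => RelMap R u) ∧
      IsExpTermDefinable (fun (K : Language.Theory.ModelType.{0, 0, w} realExpTheory)
        (u : Fin l → K) => ¬ RelMap R u) :=
  R.elim

/-- The hypotheses `hfun` for `L_e = {+, ·, -, 0, 1, ≤} ∪ {e}`. [cite: DenBesten2016, Lemma 6.2.3] -/
theorem funGraph_orderedERing {l : ℕ} (g : Language.orderedERing.Functions l) :
    IsExpTermDefinable (fun (K : Language.Theory.ModelType.{0, 0, w} realExpTheory)
      (u : Fin l ⊕ Unit → K) => u (Sum.inr ()) = funMap g (u ∘ Sum.inl)) :=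
  funGraph_sum funGraph_orderedRing funGraph_eUnary g

/-- The hypotheses `hrel` for `L_e`. [folklore] -/
theorem relDef_orderedERing {l : ℕ} (R : Language.orderedERing.Relations l) :
    IsExpTermDefinable (fun (K : Language.Theory.ModelType.{0, 0, w} realExpTheory)
        (u : Fin l → K) => RelMap R u) ∧
      IsExpTermDefinable (fun (K : Language.Theory.ModelType.{0, 0, w} realExpTheory)
        (u : Fin l → K) => ¬ RelMap R u) :=
  relDef_sum relDef_orderedRing relDef_eUnary R

/-- Sanity check: the general theorem specialises to `of_isExistential_orderedERing`
(`ETermReduction.lean`); kept as an `example`, not a second named theorem. -/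
example {γ : Type} {n : ℕ} {φ : Language.orderedERing.BoundedFormula γ n} (hφ : φ.IsExistential) :
    IsExpTermDefinable (fun (K : Language.Theory.ModelType.{0, 0, w} realExpTheory)
        (u : γ ⊕ Fin n → K) => φ.Realize (u ∘ Sum.inl) (u ∘ Sum.inr)) :=
  of_isExistential_of_graphs funGraph_orderedERing relDef_orderedERing hφ

end IsExpTermDefinable

end RealExpModel

end Literature.ModelTheory.ExponentialFields
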